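import Summits.AtomisticToContinuum.Crystallization.Theorems.OverbindingBudgetEnergyPinningStar

/-!
# OverbindingBudget · decomp-a2c lens-4 g34 — part XXII-F: the STRAIGHTENING cut of the cell-energy leaves E2T/E2S

Helper file under `--supports stmt-AtomisticToContinuum-31280` (RDEF = `Theses.OverbindingBudget.RobustDefectLimitWindows`); closes nothing.

The cell-energy leaves E2T/E2S of parts XXII-B…E (`StrainedCellEnergyT Λ₁ s₁ s₂ e`, `StrainedCellEnergyS Λ₁ t₁ t₂ e`: an admissible stacked configuration
over an UNPINNED cell has mean half site energy `≥ e` on large cubes) are cut along the proof of record (§C of the memo, STRAIGHTENING) into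
* STR `StraightenedFloor Λ₁` [ANALYTIC·M, UNDECIDED-MARGIN]: for an admissible stacked configuration with unit normal `n`, if a level `e + κ″`
  lies below the STRAIGHTENED energy `φ₀(a,b)/2 + Σ_{s≥1} layerField a b v_s` for every mean gap height `h̄` in the convex hull of the actual gap
  heights and EVERY choice of inter-layer offsets `v_s` at heights `(s+1)·h̄` (so below its lateral infimum, span by span), then the configuration
  has the mean floor `MeanSiteEnergyFloor e`.  Mechanism: bound each inter-layer term by its lateral infimum at its height; the resulting
  functional of the GAP-HEIGHT sequence is jointly convex on the clean-W height band (adjacent normal stiffness `≈ 14–21` against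
  `Σ_{s≥2} s²|φ_s''| ≈ 2`, census TAG 177 (i)); Jensen over the layer average of a cube replaces the heights by their window mean at cost
  `O(1/ℓ) + O(ℓ²/ℓ³)`, absorbed by `κ″`.  WARNING recorded: straightening in the full gap VECTOR is false (the two hcp offsets `±t` average to the
  on-top stacking) — heights only, lateral by infimum.
* GEO `StackedHeights Λ₁ η₁ η₂` [GEOMETRY·S]: the gap heights of an admissible stacked configuration lie in `[η₁, η₂]` (clean-W + separation; of
  record any band around `[0.69, 0.80] ± 0.05` containing both the T (`≈ 0.816·d`) and S (`≈ 0.707·d`) heights).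
* NUM-T `StraightCellEnergyT Λ₁ η₁ η₂ s₁ s₂ e` / NUM-S `StraightCellEnergyS Λ₁ η₁ η₂ t₁ t₂ e` [CERT·M, CONFIGURATION-FREE]: for every near-triangular
  (near-square) in-plane cell `(a, b)` with lattice vectors `≥ 9/10`, `‖a‖, ‖b‖ ≤ Λ₁`, OUTSIDE the box, every unit normal `n` and every height
  `h̄ ∈ [η₁, η₂]`: `e ≤ φ₀(a,b)/2 + Σ_{s≥1} layerField a b v_s` for all offsets `v_s` at heights `(s+1)·h̄` — a lattice-sum inequality over an explicit
  compact parameter region (interval arithmetic; margin `½Kε² − Δ_poly` of the memo).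
Seams PROVED: `strainedCellEnergyT_of_straight : 0 < κ″ → StraightenedFloor Λ₁ → StackedHeights Λ₁ η₁ η₂ → StraightCellEnergyT Λ₁ η₁ η₂ s₁ s₂ (e + κ″) →
StrainedCellEnergyT Λ₁ s₁ s₂ e` (and S); cones XXVII `rdef_twentyseventh_of_recordK_straight[_ref]`: beneath ★ the open leaves are STR, GEO, NUM-T, NUM-S at
level `e⋆ + 2κ′` (heights band `[η₁, η₂]` and boxes SYMBOLIC).
-/

noncomputable section

namespace Summit.AtomisticToContinuum.Crystallization.Theorems.OverbindingBudgetEnergyStraightening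

open Metric
open scoped RealInnerProductSpace
open Literature.MathematicalPhysics.StatisticalMechanics (lennardJones groundStateEnergy)
open Summit.AtomisticToContinuum.Crystallization.Theses.OverbindingBudget (RobustDefectLimitWindows)
open Summit.AtomisticToContinuum.Crystallization.Theses.PricedLinkCensus (ChargedEnergyGap)
open Summit.AtomisticToContinuum.Crystallization.Theorems.ChargedEnergyGapNegative (eStar)
open Summit.AtomisticToContinuum.Crystallization.Theorems.OverbindingBudgetGradedBareness (CleanlessExcessT)
open Summit.AtomisticToContinuum.Crystallization.Theorems.OverbindingBudgetCoherentCut (CoherentResidual)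
open Summit.AtomisticToContinuum.Crystallization.Theorems.OverbindingBudgetUniformCutStatements (GrossCleanBallsU)
open Summit.AtomisticToContinuum.Crystallization.Theorems.OverbindingBudgetElasticSplitScale (CompressedVirialLaw)
open Summit.AtomisticToContinuum.Crystallization.Theorems.OverbindingBudgetElasticSplitShear (StressFree)
open Summit.AtomisticToContinuum.Crystallization.Theorems.ChartedPlanarOrderChunkFloor (E3)
open Summit.AtomisticToContinuum.Crystallization.Theorems.ChartedPlanarOrderRigidityDoor (IsNash)
open Summit.AtomisticToContinuum.Crystallization.Theorems.ChartedPlanarOrderDensityDichotomy (μS IsSep)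
open Summit.AtomisticToContinuum.Crystallization.Theorems.ChartedPlanarOrderDoorLayered (Layered)
open Summit.AtomisticToContinuum.Crystallization.Theorems.ChartedPlanarOrderProfileSlavingLJ (IsStacked gapStress incr)
open Summit.AtomisticToContinuum.Crystallization.Theorems.ChartedPlanarOrderTubeConvex (TubeConvexW' TubeConvexRef)
open Summit.AtomisticToContinuum.Crystallization.Theorems.OverbindingBudgetScaleWidening (IsCleanW DoorPeriodicW)
open Summit.AtomisticToContinuum.Crystallization.Theorems.OverbindingBudgetTwoShellShape (TwoShellShape BarlowGluingW)
open Summit.AtomisticToContinuum.Crystallization.Theorems.OverbindingBudgetStackedRigidityW (StackedReductionW GapStressVanishesW)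
open Summit.AtomisticToContinuum.Crystallization.Theorems.OverbindingBudgetStackedRigidityRef (RegistryPinningW)
open Summit.AtomisticToContinuum.Crystallization.Theorems.OverbindingBudgetRegistryCut (IsUnitNormal Pinned RegistryResidual RegistryTube RegistryMetric)
open Summit.AtomisticToContinuum.Crystallization.Theorems.OverbindingBudgetRegistrySquare (PinnedSq)
open Summit.AtomisticToContinuum.Crystallization.Theorems.OverbindingBudgetRegistryDichotomy (IsTType IsSType RegistryGeometryW BalancedLocus
  SqRegistryGeometryW SqBalancedHeight SqRegistryMetric)
open Summit.AtomisticToContinuum.Crystallization.Theorems.OverbindingBudgetRegistryDichotomyCW (RegistryMetricCW SqRegistryMetricCW)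
open Summit.AtomisticToContinuum.Crystallization.Theorems.OverbindingBudgetEnergyPinning (StackedCellPinningU)
open Summit.AtomisticToContinuum.Crystallization.Theorems.OverbindingBudgetEnergyPinningCut (MeanSiteEnergyFloor StrainedCellEnergyT StrainedCellEnergyS)
open Summit.AtomisticToContinuum.Crystallization.Theorems.OverbindingBudgetEnergyPinningStar (stackedCellPinningU_of_cellEnergy_eStar
  rdef_twentysixth_of_recordK_energy_eStar rdef_twentysixth_of_recordK_energy_eStar_ref)

/-! ## §1 The straightened comparison energy -/

/-- **the field of a full in-plane layer** `ℤa + ℤb` at the point at offset `v` from it: `Σ_{(i,j) ∈ ℤ²} V_LJ ‖v + (i a + j b)‖` (junk `0` if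
divergent; at `v = 0` it is the in-plane self field `φ₀(a,b)`, the `(0,0)` term being `V_LJ(0) = 0`). Mirrors `ChartedPlanarOrderProfileSlavingLJ.layerForce`. -/
def layerField (a b v : E3) : ℝ := ∑' ij : ℤ × ℤ, lennardJones ‖v + (((ij.1 : ℤ) : ℝ) • a + ((ij.2 : ℤ) : ℝ) • b)‖

/-- **`StraightBound a b n h e`**: the level `e` lies below the straightened half site energy of the uniform stack over `(a, b)` with gap height `h`
for EVERY choice of the inter-layer offsets `v s` at heights `(s+1)·h` (`s = 0, 1, …`), i.e. below its span-wise lateral infimum: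
`e ≤ φ₀(a,b)/2 + Σ_{s} layerField a b (v s)` (the layers above and below contribute equally, whence no factor `½` on the inter-layer part). -/
def StraightBound (a b n : E3) (h e : ℝ) : Prop :=
  ∀ v : ℕ → E3, (∀ s : ℕ, ⟪v s, n⟫ = ((s : ℝ) + 1) * h) → e ≤ layerField a b 0 / 2 + ∑' s : ℕ, layerField a b (v s)

/-! ## §2 The three pieces -/

/-- **STR · `StraightenedFloor Λ₁`** — STRAIGHTENING [ANALYTIC·M, UNDECIDED-MARGIN]: an admissible stacked configuration (7d's binders verbatim) with
unit normal `n` (gap heights `> 0` along `n`) whose straightened energy dominates `e + κ″` at every mean height in the convex hull of its gap heights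
has the mean floor `MeanSiteEnergyFloor e`.  Why it might fail: joint convexity of the laterally-minimised stack energy in the gap HEIGHTS could fail
on the clean-W height band (it holds with adjacent stiffness `≈ 14–21` against far curvature `≈ 2` at the census numbers, TAG 177 (i)); the window-mean
drift and the cube boundary are `o(#F)` and harmless. [piece] -/
def StraightenedFloor (Λ₁ : ℝ) : Prop :=
  ∀ δ : ℝ, 9 / 10 ≤ δ → ∀ (a b : E3) (w : ℤ → E3), IsStacked a b w → LinearIndependent ℝ ![a, b] →
    ‖a‖ ≤ Λ₁ → ‖b‖ ≤ Λ₁ → IsSep δ (Layered a b w) → IsCleanW (μS (Layered a b w)) → IsNash (μS (Layered a b w)) →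
    StressFree (Layered a b w) → (∀ m : ℤ, gapStress a b m (incr w) = 0) →
    ∀ n : E3, IsUnitNormal a b n → (∀ m : ℤ, 0 < ⟪incr w m, n⟫) →
    ∀ e κ'' : ℝ, 0 < κ'' → (∀ h ∈ convexHull ℝ (Set.range fun m : ℤ => ⟪incr w m, n⟫), StraightBound a b n h (e + κ'')) →
    MeanSiteEnergyFloor e (Layered a b w)

/-- **GEO · `StackedHeights Λ₁ η₁ η₂`** [GEOMETRY·S]: the gap heights of an admissible stacked configuration lie in the band `[η₁, η₂]`.  Why it might fail:
only if the band is set narrower than the clean-W heights of the T (`≈ 0.816 d`) and S (`≈ 0.707 d`) cells over the admissible in-plane cells. [piece] -/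
def StackedHeights (Λ₁ η₁ η₂ : ℝ) : Prop :=
  ∀ δ : ℝ, 9 / 10 ≤ δ → ∀ (a b : E3) (w : ℤ → E3), IsStacked a b w → LinearIndependent ℝ ![a, b] →
    ‖a‖ ≤ Λ₁ → ‖b‖ ≤ Λ₁ → IsSep δ (Layered a b w) → IsCleanW (μS (Layered a b w)) → IsNash (μS (Layered a b w)) →
    StressFree (Layered a b w) → (∀ m : ℤ, gapStress a b m (incr w) = 0) →
    ∀ n : E3, IsUnitNormal a b n → (∀ m : ℤ, 0 < ⟪incr w m, n⟫) → ∀ m : ℤ, η₁ ≤ ⟪incr w m, n⟫ ∧ ⟪incr w m, n⟫ ≤ η₂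

/-- **NUM-T · `StraightCellEnergyT Λ₁ η₁ η₂ s₁ s₂ e`** [CERT·M, configuration-free]: for every near-triangular in-plane cell `(a, b)` with lattice vectors
`≥ 9/10`, `‖a‖, ‖b‖ ≤ Λ₁`, NOT pinned in `[s₁, s₂]`, every unit normal and every height `h̄ ∈ [η₁, η₂]`, the level `e` lies below the straightened
energy for all inter-layer offsets.  Why it might fail: the in-plane elastic penalty at the box edge (`½Kε²`, `K ≈ 8.6` iso / `≈ 2` dev) must beat the
span-wise lateral-minimisation loss `Δ_poly ≈ 1–2·10⁻⁴` plus `e − e⋆`; too narrow a box fails (census TAG 183). [piece] -/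
def StraightCellEnergyT (Λ₁ η₁ η₂ s₁ s₂ e : ℝ) : Prop :=
  ∀ (a b n : E3), LinearIndependent ℝ ![a, b] → ‖a‖ ≤ Λ₁ → ‖b‖ ≤ Λ₁ →
    (∀ i j : ℤ, ((i : ℝ) • a + (j : ℝ) • b) ≠ 0 → 9 / 10 ≤ ‖(i : ℝ) • a + (j : ℝ) • b‖) → IsUnitNormal a b n → IsTType a b →
    ¬ Pinned s₁ s₂ a b → ∀ h : ℝ, η₁ ≤ h → h ≤ η₂ → StraightBound a b n h e

/-- **NUM-S · `StraightCellEnergyS Λ₁ η₁ η₂ t₁ t₂ e`** [CERT·M, configuration-free]: the square-layer twin (`IsSType`, box `PinnedSq t₁ t₂`). [piece] -/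
def StraightCellEnergyS (Λ₁ η₁ η₂ t₁ t₂ e : ℝ) : Prop :=
  ∀ (a b n : E3), LinearIndependent ℝ ![a, b] → ‖a‖ ≤ Λ₁ → ‖b‖ ≤ Λ₁ →
    (∀ i j : ℤ, ((i : ℝ) • a + (j : ℝ) • b) ≠ 0 → 9 / 10 ≤ ‖(i : ℝ) • a + (j : ℝ) • b‖) → IsUnitNormal a b n → IsSType a b →
    ¬ PinnedSq t₁ t₂ a b → ∀ h : ℝ, η₁ ≤ h → h ≤ η₂ → StraightBound a b n h e

/-! ## §3 Seams: E2T ⟸ STR ∧ GEO ∧ NUM-T, E2S ⟸ STR ∧ GEO ∧ NUM-S (PROVED) -/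

/-- A height-sorted representation has a UNIT normal with positive gap heights. [bookkeeping] -/
theorem exists_unitNormal_of_isStacked {a b : E3} {w : ℤ → E3} (hst : IsStacked a b w) :
    ∃ n : E3, IsUnitNormal a b n ∧ ∀ m : ℤ, 0 < ⟪incr w m, n⟫ := by
  obtain ⟨n₀, ha, hb, hpos⟩ := hst
  have hn₀ : n₀ ≠ 0 := by
    intro h
    have := hpos 0
    rw [h, inner_zero_left] at this
    exact lt_irrefl _ this
  have hnorm : 0 < ‖n₀‖ := norm_pos_iff.2 hn₀
  refine ⟨‖n₀‖⁻¹ • n₀, ⟨?_, ?_, ?_⟩, fun m => ?_⟩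
  · rw [norm_smul, norm_inv, norm_norm, inv_mul_cancel₀ hnorm.ne']
  · rw [real_inner_smul_left, ha, mul_zero]
  · rw [real_inner_smul_left, hb, mul_zero]
  · have h1 : ⟪incr w m, ‖n₀‖⁻¹ • n₀⟫ = ‖n₀‖⁻¹ * ⟪n₀, w (m - 1 + 1) - w (m - 1)⟫ := by
      rw [real_inner_smul_right, real_inner_comm, sub_add_cancel]
      rfl
    rw [h1]
    exact mul_pos (inv_pos.2 hnorm) (hpos (m - 1))

/-- In-plane lattice vectors of a `δ`-separated layered configuration have norm `≥ δ`. [bookkeeping] -/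
theorem le_norm_latticeVec_of_isSep {δ : ℝ} {a b : E3} {w : ℤ → E3} (hs : IsSep δ (Layered a b w)) (i j : ℤ)
    (hij : ((i : ℝ) • a + (j : ℝ) • b) ≠ 0) : δ ≤ ‖(i : ℝ) • a + (j : ℝ) • b‖ := by
  have h1 : ((i : ℝ) • a + (j : ℝ) • b) + w 0 ∈ Layered a b w := ⟨0, i, j, rfl⟩
  have h0 : w 0 ∈ Layered a b w := ⟨0, 0, 0, by simp⟩
  have hne : ((i : ℝ) • a + (j : ℝ) • b) + w 0 ≠ w 0 := by
    intro h
    apply hij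
    have : ((i : ℝ) • a + (j : ℝ) • b) + w 0 - w 0 = 0 := by rw [h, sub_self]
    simpa using this
  have h := hs _ h1 _ h0 hne
  rwa [dist_eq_norm, add_sub_cancel_right] at h

/-- The convex hull of a set of reals inside `[η₁, η₂]` stays inside. [bookkeeping] -/
theorem convexHull_range_subset_Icc {η₁ η₂ : ℝ} {f : ℤ → ℝ} (hf : ∀ m, η₁ ≤ f m ∧ f m ≤ η₂) :
    convexHull ℝ (Set.range f) ⊆ Set.Icc η₁ η₂ :=
  convexHull_min (by rintro _ ⟨m, rfl⟩; exact ⟨(hf m).1, (hf m).2⟩) (convex_Icc η₁ η₂)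

/-- ★ **E2T from the straightening cut.** `0 < κ″ → StraightenedFloor Λ₁ → StackedHeights Λ₁ η₁ η₂ → StraightCellEnergyT Λ₁ η₁ η₂ s₁ s₂ (e + κ″) →
StrainedCellEnergyT Λ₁ s₁ s₂ e`. [this file] -/
theorem strainedCellEnergyT_of_straight {Λ₁ η₁ η₂ s₁ s₂ e κ'' : ℝ} (hκ : 0 < κ'') (hSTR : StraightenedFloor Λ₁) (hGEO : StackedHeights Λ₁ η₁ η₂)
    (hNUM : StraightCellEnergyT Λ₁ η₁ η₂ s₁ s₂ (e + κ'')) : StrainedCellEnergyT Λ₁ s₁ s₂ e := by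
  intro δ hδ a b w hst hab ha hb hs hc hna hf hz hT hnp
  obtain ⟨n, hn, hpos⟩ := exists_unitNormal_of_isStacked hst
  have hlat : ∀ i j : ℤ, ((i : ℝ) • a + (j : ℝ) • b) ≠ 0 → 9 / 10 ≤ ‖(i : ℝ) • a + (j : ℝ) • b‖ :=
    fun i j hij => hδ.trans (le_norm_latticeVec_of_isSep hs i j hij)
  have hband := convexHull_range_subset_Icc (hGEO δ hδ a b w hst hab ha hb hs hc hna hf hz n hn hpos)
  refine hSTR δ hδ a b w hst hab ha hb hs hc hna hf hz n hn hpos e κ'' hκ fun h hh => ?_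
  exact hNUM a b n hab ha hb hlat hn hT hnp h (hband hh).1 (hband hh).2

/-- ★ **E2S from the straightening cut.** [this file] -/
theorem strainedCellEnergyS_of_straight {Λ₁ η₁ η₂ t₁ t₂ e κ'' : ℝ} (hκ : 0 < κ'') (hSTR : StraightenedFloor Λ₁) (hGEO : StackedHeights Λ₁ η₁ η₂)
    (hNUM : StraightCellEnergyS Λ₁ η₁ η₂ t₁ t₂ (e + κ'')) : StrainedCellEnergyS Λ₁ t₁ t₂ e := by
  intro δ hδ a b w hst hab ha hb hs hc hna hf hz hS hnp
  obtain ⟨n, hn, hpos⟩ := exists_unitNormal_of_isStacked hst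
  have hlat : ∀ i j : ℤ, ((i : ℝ) • a + (j : ℝ) • b) ≠ 0 → 9 / 10 ≤ ‖(i : ℝ) • a + (j : ℝ) • b‖ :=
    fun i j hij => hδ.trans (le_norm_latticeVec_of_isSep hs i j hij)
  have hband := convexHull_range_subset_Icc (hGEO δ hδ a b w hst hab ha hb hs hc hna hf hz n hn hpos)
  refine hSTR δ hδ a b w hst hab ha hb hs hc hna hf hz n hn hpos e κ'' hκ fun h hh => ?_
  exact hNUM a b n hab ha hb hlat hn hS hnp h (hband hh).1 (hband hh).2

/-- ★ **the energy cut at the sharp level through the straightening cut:** STR ∧ GEO ∧ NUM-T(e⋆ + 2κ′) ∧ NUM-S(e⋆ + 2κ′) ⇒ ★ `StackedCellPinningU`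
(`0 < κ′`, `Λ₁ ≤ 17/16`). [this file] -/
theorem stackedCellPinningU_of_straight {Λ₁ η₁ η₂ s₁ s₂ t₁ t₂ κ' : ℝ} (hκ' : 0 < κ') (hΛ₁ : Λ₁ ≤ 17 / 16) (hSTR : StraightenedFloor Λ₁)
    (hGEO : StackedHeights Λ₁ η₁ η₂) (hT : StraightCellEnergyT Λ₁ η₁ η₂ s₁ s₂ (eStar + 2 * κ'))
    (hS : StraightCellEnergyS Λ₁ η₁ η₂ t₁ t₂ (eStar + 2 * κ')) : StackedCellPinningU Λ₁ s₁ s₂ t₁ t₂ := by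
  have e2 : eStar + 2 * κ' = eStar + κ' + κ' := by ring
  rw [e2] at hT hS
  exact stackedCellPinningU_of_cellEnergy_eStar hκ' hΛ₁ (strainedCellEnergyT_of_straight hκ' hSTR hGEO hT)
    (strainedCellEnergyS_of_straight hκ' hSTR hGEO hS)

/-! ## §4 Cones XXVII: beneath ★ the open leaves are STR, GEO, NUM-T, NUM-S -/

/-- ★ **RDEF cone, TWENTY-SEVENTH form at the numbers of record: ENERGY PINNING through STRAIGHTENING** (W′ currency): beneath 7d the open energy
leaves are STR `StraightenedFloor (17/16)` [ANALYTIC·M], GEO `StackedHeights (17/16) η₁ η₂` [GEOMETRY·S], NUM-T `StraightCellEnergyT (17/16) η₁ η₂ s₁ s₂ (e⋆ + 2κ′)`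
and NUM-S `StraightCellEnergyS (17/16) η₁ η₂ t₁ t₂ (e⋆ + 2κ′)` [CERT·M]; height band and boxes SYMBOLIC. [this file] -/
theorem rdef_twentyseventh_of_recordK_straight (s₁ s₂ t₁ t₂ h₀ h₁ η₁ η₂ κ' : ℝ) (hκ' : 0 < κ') (hG : GrossCleanBallsU (1 / 250) 10)
    (hCEG : ChargedEnergyGap) (hC : CompressedVirialLaw (1 / 250) 10) (hS : TwoShellShape (1 / 100) (3 / 50) (1 / 450)) (hB₂ : BarlowGluingW)
    (hD : DoorPeriodicW 2) (hSR : StackedReductionW 2 (17 / 16)) (hV : GapStressVanishesW (17 / 16))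
    (hP : RegistryPinningW (17 / 16) (1 / 40) (3 / 16)) (hT : TubeConvexW' (17 / 16) (1 / 40)) (hSTR : StraightenedFloor (17 / 16))
    (hGEO : StackedHeights (17 / 16) η₁ η₂) (hNT : StraightCellEnergyT (17 / 16) η₁ η₂ s₁ s₂ (eStar + 2 * κ'))
    (hNS : StraightCellEnergyS (17 / 16) η₁ η₂ t₁ t₂ (eStar + 2 * κ')) (hGeo : RegistryGeometryW (17 / 16) s₁ s₂ h₀ (3 / 20))
    (hBal : BalancedLocus s₁ s₂ h₀ (1 / 40)) (hR1 : RegistryResidual s₁ s₂ (1 / 250)) (hR2 : RegistryTube s₁ s₂ (1 / 100) 1)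
    (hMet : RegistryMetric s₁ s₂ (3 / 500)) (hSqGeo : SqRegistryGeometryW (17 / 16) t₁ t₂ h₁ (3 / 20)) (hSqH : SqBalancedHeight t₁ t₂ h₁ (1 / 100))
    (hSqMet : SqRegistryMetric t₁ t₂ h₁ (1 / 100) 0) (hCE : CleanlessExcessT) (hRes : CoherentResidual 10) : RobustDefectLimitWindows :=
  have e2 : eStar + 2 * κ' = eStar + κ' + κ' := by ring
  rdef_twentysixth_of_recordK_energy_eStar s₁ s₂ t₁ t₂ h₀ h₁ κ' hκ' hG hCEG hC hS hB₂ hD hSR hV hP hT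
    (strainedCellEnergyT_of_straight hκ' hSTR hGEO (e2 ▸ hNT)) (strainedCellEnergyS_of_straight hκ' hSTR hGEO (e2 ▸ hNS)) hGeo hBal hR1 hR2 hMet
    hSqGeo hSqH hSqMet hCE hRes

/-- ★ **RDEF cone, twenty-seventh form at the numbers of record, reference-centred (CURRENCY OF RECORD): ENERGY PINNING through STRAIGHTENING.**
[this file] -/
theorem rdef_twentyseventh_of_recordK_straight_ref (s₁ s₂ t₁ t₂ h₀ h₁ η₁ η₂ κ' : ℝ) (hκ' : 0 < κ') (hG : GrossCleanBallsU (1 / 250) 10)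
    (hCEG : ChargedEnergyGap) (hC : CompressedVirialLaw (1 / 250) 10) (hS : TwoShellShape (1 / 100) (3 / 50) (1 / 450)) (hB₂ : BarlowGluingW)
    (hD : DoorPeriodicW 2) (hSR : StackedReductionW 2 (17 / 16)) (hV : GapStressVanishesW (17 / 16))
    (hP : RegistryPinningW (17 / 16) (1 / 40) (3 / 16)) (hT : TubeConvexRef (17 / 16) (1 / 40)) (hSTR : StraightenedFloor (17 / 16))
    (hGEO : StackedHeights (17 / 16) η₁ η₂) (hNT : StraightCellEnergyT (17 / 16) η₁ η₂ s₁ s₂ (eStar + 2 * κ'))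
    (hNS : StraightCellEnergyS (17 / 16) η₁ η₂ t₁ t₂ (eStar + 2 * κ')) (hGeo : RegistryGeometryW (17 / 16) s₁ s₂ h₀ (3 / 20))
    (hBal : BalancedLocus s₁ s₂ h₀ (1 / 40)) (hR1 : RegistryResidual s₁ s₂ (1 / 250)) (hR2 : RegistryTube s₁ s₂ (1 / 100) 1)
    (hMet : RegistryMetricCW s₁ s₂ (3 / 500)) (hSqGeo : SqRegistryGeometryW (17 / 16) t₁ t₂ h₁ (3 / 20))
    (hSqH : SqBalancedHeight t₁ t₂ h₁ (1 / 100)) (hSqMet : SqRegistryMetricCW t₁ t₂ h₁ (1 / 100) 0) (hCE : CleanlessExcessT)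
    (hRes : CoherentResidual 10) : RobustDefectLimitWindows :=
  have e2 : eStar + 2 * κ' = eStar + κ' + κ' := by ring
  rdef_twentysixth_of_recordK_energy_eStar_ref s₁ s₂ t₁ t₂ h₀ h₁ κ' hκ' hG hCEG hC hS hB₂ hD hSR hV hP hT
    (strainedCellEnergyT_of_straight hκ' hSTR hGEO (e2 ▸ hNT)) (strainedCellEnergyS_of_straight hκ' hSTR hGEO (e2 ▸ hNS)) hGeo hBal hR1 hR2 hMet
    hSqGeo hSqH hSqMet hCE hRes

end Summit.AtomisticToContinuum.Crystallization.Theorems.OverbindingBudgetEnergyStraightening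

end
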